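import Literature.NumberTheory.GaloisRepresentations.NormSubgroupTower
import Literature.NumberTheory.NumberFields.NarrowClassGroup
import HarnessLib

/-!
# Change of modulus in the ray class group: `#Cl_K^{𝔪'} = #Cl_K^{𝔪} · #ker((𝓞/𝔪')ˣ → (𝓞/𝔪)ˣ)`
# for `𝔪 ∣ 𝔪'` with the same prime support and no non-trivial unit `≡ 1 mod 𝔪`
# (Neukirch, *Algebraic Number Theory*, VI (1.9) / the exact sequence
# `1 → (𝓞/𝔪)ˣ/𝓞ˣ → Cl_K^𝔪 → Cl_K → 1`)

Neukirch, *Algebraic Number Theory* (1999), Ch. VI §1 (1.9) and Exercise 13 (p. 368): the ray class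
group `Cl_K^𝔪 = J_K^𝔪/P_K^𝔪` sits in the exact sequence
`1 → 𝓞ˣ/𝓞ˣ_{𝔪,1} → (𝓞/𝔪)ˣ → Cl_K^𝔪 → Cl_K → 1`; comparing two moduli `𝔪 ∣ 𝔪'` with the SAME
prime divisors (so that `J_K^𝔪 = J_K^{𝔪'}`) gives
`1 → ker((𝓞/𝔪')ˣ → (𝓞/𝔪)ˣ)/(units) → Cl_K^{𝔪'} → Cl_K^{𝔪} → 1`, and when NO UNIT other than `1` is
`≡ 1 mod 𝔪` (de Shalit's `w_𝔪 = 1`, *Iwasawa theory of elliptic curves with CM* II.1.7–1.9), the kernel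
`P_K^𝔪/P_K^{𝔪'}` is exactly `ker((𝓞/𝔪')ˣ → (𝓞/𝔪)ˣ)`.

This file proves the cardinality form for a TOTALLY COMPLEX `K` (no real places, so the
narrow/wide distinction of the tree's `rayElements` is void), in the vocabulary of
`RayClassGroup.lean` (`idealsPrimeTo 𝔪 = J_K^𝔪`, `rayElements 𝔪 ⊆ Kˣ`, `ray 𝔪 = P_K^𝔪`,
`RayClassGroup 𝔪 = J_K^𝔪/P_K^𝔪`):

* §1 support and monotonicity: `idealsPrimeTo_eq_of_forall_le_iff`, `rayElements_anti`, `ray_anti`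
  (with the tree's `modulusExp_le_of_dvd`, `NormSubgroupTower.lean`);
* §2 the dictionary between `rayElements` and congruences of integers (no real places):
  `not_nonempty_ringHom_real`, `unitsMk0_div_mem_rayElements_of_sub_mem` (positivity-free form of
  `unitsMk0_div_mem_rayElements`), `unitsMk0_mem_rayElements_of_sub_one_mem`,
  `sub_mem_of_unitsMk0_div_mem_rayElements`, `sub_one_mem_of_unitsMk0_mem_rayElements`,
  `units_eq_one_of_mem_rayElements` (`w_𝔪 = 1` read on `rayElements`);
* §3 `natCard_rayClassGroup_eq_relIndex` (`#Cl^𝔪 = [J^𝔪 : P^𝔪]`),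
  `relIndex_ray_mul` (`[J : P'] = [J : P]·[P : P']`);
* §4 ★ `relIndex_ray_ray_eq_natCard_ker` — for `w_𝔪 = 1`: **`[P^𝔪 : P^{𝔪'}] = #ker((𝓞/𝔪')ˣ → (𝓞/𝔪)ˣ)`**
  (an explicit bijection: a kernel class `r mod 𝔪'`, `r ≡ 1 mod 𝔪`, goes to `(r)·P^{𝔪'}`; injective by
  `w_𝔪 = 1`, surjective by inverting denominators modulo `𝔪'`);
* §5 ★★ **`natCard_rayClassGroup_eq_mul_natCard_ker`**: `#Cl^{𝔪'} = #Cl^{𝔪} · #ker` — the input of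
  `[K(𝔪') : K(𝔪)] = #ker` (`finrank_rayClassField`) for the division-field layers
  `K(𝔣𝔭^{n+1})/K(𝔣𝔭)` of de Shalit II.1.9 / II.4.6.

Everything is a theorem; no definitions, no named facts, no instances, no `sorry`.

## References

* [NeukirchANT1999] J. Neukirch, *Algebraic Number Theory* (1999), Ch. VI §1 Prop. (1.9), Exercise 13.
* [deShalit1987] E. de Shalit, *Iwasawa theory of elliptic curves with complex multiplication* (1987),
  II.1.7–1.9 (p. 41–43).
-/

noncomputable section

open NumberField IsDedekindDomain IsDedekindDomain.HeightOneSpectrum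
open scoped nonZeroDivisors Classical

namespace Literature.NumberTheory.GaloisRepresentations

variable {K : Type*} [Field K] [NumberField K]

/-! ### §1. Support and monotonicity -/

/-- Moduli with the same prime divisors have the same group `J_K^𝔪` of ideals prime to them.
[cite: NeukirchANT1999, Ch. VI §1 Prop. (1.9)] -/
theorem idealsPrimeTo_eq_of_forall_le_iff {𝔪 𝔪' : Ideal (𝓞 K)}
    (h : ∀ v : HeightOneSpectrum (𝓞 K), 𝔪 ≤ v.asIdeal ↔ 𝔪' ≤ v.asIdeal) :
    idealsPrimeTo 𝔪 = idealsPrimeTo 𝔪' := by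
  ext I
  simp only [mem_idealsPrimeTo_iff]
  exact ⟨fun hI v hv ↦ hI v ((h v).mpr hv), fun hI v hv ↦ hI v ((h v).mp hv)⟩

/-- **`a ≡ 1 mod 𝔪' ⟹ a ≡ 1 mod 𝔪` for `𝔪 ∣ 𝔪'`** (`rayElements` is antitone in the modulus).
[cite: NeukirchANT1999, Ch. VI §1 Prop. (1.9)] -/
theorem rayElements_anti {𝔪 𝔪' : Ideal (𝓞 K)} (h𝔪' : 𝔪' ≠ ⊥) (hdvd : 𝔪 ∣ 𝔪') :
    rayElements 𝔪' ≤ rayElements (K := K) 𝔪 := by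
  intro a ha
  rw [mem_rayElements_iff] at ha ⊢
  refine ⟨fun v hv ↦ ?_, ha.2⟩
  have hle := modulusExp_le_of_dvd hdvd h𝔪' v
  have hv' : modulusExp 𝔪' v ≠ 0 := fun h ↦ hv (Nat.le_zero.mp (h ▸ hle))
  refine (ha.1 v hv').trans ?_
  rw [WithZero.exp_le_exp]
  omega

/-- `P_K^{𝔪'} ≤ P_K^{𝔪}` for `𝔪 ∣ 𝔪'`. [cite: NeukirchANT1999, Ch. VI §1 Prop. (1.9)] -/
theorem ray_anti {𝔪 𝔪' : Ideal (𝓞 K)} (h𝔪' : 𝔪' ≠ ⊥) (hdvd : 𝔪 ∣ 𝔪') :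
    ray 𝔪' ≤ ray (K := K) 𝔪 :=
  Subgroup.map_mono (rayElements_anti h𝔪' hdvd)

/-! ### §2. `rayElements` versus congruences of integers (no real places) -/

omit [NumberField K] in
/-- A totally complex number field has no ring homomorphism to `ℝ`.
[cite: NeukirchANT1999, Ch. VI §1 Remark p. 363] -/
theorem not_nonempty_ringHom_real [NumberField K] [IsTotallyComplex K] (φ : K →+* ℝ) : False := by
  have hreal : ComplexEmbedding.IsReal (Complex.ofRealHom.comp φ) := by
    ext x
    simp
  have h1 : (InfinitePlace.mk (Complex.ofRealHom.comp φ)).IsReal := ⟨_, hreal, rfl⟩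
  exact InfinitePlace.not_isReal_iff_isComplex.mpr (IsTotallyComplex.isComplex _) h1

/-- **`b/c ≡ 1 mod 𝔪` for integers `b ≡ c mod 𝔪`, `c` prime to `𝔪`** (totally complex `K`: no
positivity condition). [cite: NeukirchANT1999, Ch. VI §1 Prop. (1.9)] -/
theorem unitsMk0_div_mem_rayElements_of_sub_mem [IsTotallyComplex K] {𝔪 : Ideal (𝓞 K)} (h𝔪 : 𝔪 ≠ ⊥)
    {b c : 𝓞 K} (hb : b ≠ 0) (hc : c ≠ 0) (hcop : IsCoprime (Ideal.span {c}) 𝔪) (hbc : b - c ∈ 𝔪) :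
    Units.mk0 ((b : K) / (c : K)) (div_ne_zero (by exact_mod_cast hb) (by exact_mod_cast hc)) ∈
      rayElements 𝔪 :=
  unitsMk0_div_mem_rayElements h𝔪 hb hc hcop hbc (fun φ ↦ (not_nonempty_ringHom_real φ).elim)

/-- **An integer `r ≡ 1 mod 𝔪` is `≡ 1 mod 𝔪` as an element of `Kˣ`** (`r - 1 ∈ 𝔪 ⊆ 𝔭^{n_𝔭}`).
[cite: NeukirchANT1999, Ch. VI §1 Prop. (1.9)] -/
theorem unitsMk0_mem_rayElements_of_sub_one_mem [IsTotallyComplex K] {𝔪 : Ideal (𝓞 K)}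
    {r : 𝓞 K} (hr0 : r ≠ 0) (hr : r - 1 ∈ 𝔪) :
    Units.mk0 (r : K) (by exact_mod_cast hr0) ∈ rayElements 𝔪 := by
  rw [mem_rayElements_iff]
  refine ⟨fun v _ ↦ ?_, fun φ ↦ (not_nonempty_ringHom_real φ).elim⟩
  have hmem : r - 1 ∈ v.asIdeal ^ modulusExp 𝔪 v := Ideal.le_of_dvd (pow_modulusExp_dvd v) hr
  rw [← intValuation_le_pow_iff_mem, ← valuation_of_algebraMap (K := K)] at hmem
  change v.valuation K (algebraMap (𝓞 K) K (r - 1)) ≤ _ at hmem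
  rw [map_sub, map_one] at hmem
  rw [Units.val_mk0]
  exact hmem

omit [NumberField K] in
/-- Cancelling a factor prime to `𝔪`: `x c ∈ 𝔪`, `(c) + 𝔪 = 1` ⟹ `x ∈ 𝔪`.
[cite: NeukirchANT1999, Ch. VI §1 Prop. (1.9)] -/
theorem mem_of_mul_mem_of_isCoprime_span [NumberField K] {𝔪 : Ideal (𝓞 K)} {x c : 𝓞 K}
    (hcop : IsCoprime (Ideal.span {c}) 𝔪) (h : x * c ∈ 𝔪) : x ∈ 𝔪 := by
  obtain ⟨i, hi, j, hj, hij⟩ := Ideal.isCoprime_iff_exists.mp hcop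
  obtain ⟨a, rfl⟩ := Ideal.mem_span_singleton'.mp hi
  have hx : x = a * (x * c) + x * j := by
    calc x = x * (a * c + j) := by rw [hij, mul_one]
      _ = a * (x * c) + x * j := by ring
  rw [hx]
  exact 𝔪.add_mem (𝔪.mul_mem_left _ h) (𝔪.mul_mem_left _ hj)

/-- **Converse: `b/c ≡ 1 mod 𝔪` forces `b ≡ c mod 𝔪`.** [cite: NeukirchANT1999, Ch. VI §1 Prop. (1.9)] -/
theorem sub_mem_of_unitsMk0_div_mem_rayElements {𝔪 : Ideal (𝓞 K)} (h𝔪 : 𝔪 ≠ ⊥) {b c : 𝓞 K}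
    (hb : b ≠ 0) (hc : c ≠ 0)
    (h : Units.mk0 ((b : K) / (c : K)) (div_ne_zero (by exact_mod_cast hb) (by exact_mod_cast hc)) ∈
      rayElements 𝔪) : b - c ∈ 𝔪 := by
  obtain ⟨b', c', -, hc', hcop', hbc', -, heq⟩ := exists_eq_div_of_mem_rayElements h𝔪 h
  rw [Units.val_mk0] at heq
  have hcK : (c : K) ≠ 0 := by exact_mod_cast hc
  have hc'K : (c' : K) ≠ 0 := by exact_mod_cast hc'
  -- `b c' = b' c` in `𝓞 K`
  have hcross : b * c' = b' * c := by
    have : (b : K) * (c' : K) = (b' : K) * (c : K) := (div_eq_div_iff hcK hc'K).mp heq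
    exact_mod_cast this
  -- `(b - c) c' = (b' - c') c ∈ 𝔪`, then cancel `c'`
  have hmem : (b - c) * c' ∈ 𝔪 := by
    have : (b - c) * c' = (b' - c') * c := by ring_nf; rw [hcross]; ring
    rw [this]
    exact 𝔪.mul_mem_right _ hbc'
  exact mem_of_mul_mem_of_isCoprime_span hcop' hmem

/-- **An integer that is `≡ 1 mod 𝔪` in `Kˣ` satisfies `r - 1 ∈ 𝔪`** (converse of
`unitsMk0_mem_rayElements_of_sub_one_mem`). [cite: NeukirchANT1999, Ch. VI §1 Prop. (1.9)] -/
theorem sub_one_mem_of_unitsMk0_mem_rayElements {𝔪 : Ideal (𝓞 K)} (h𝔪 : 𝔪 ≠ ⊥) {r : 𝓞 K}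
    (hr0 : r ≠ 0) (h : Units.mk0 (r : K) (by exact_mod_cast hr0) ∈ rayElements 𝔪) : r - 1 ∈ 𝔪 := by
  refine mem_of_forall_mem_pow_modulusExp h𝔪 fun v hv ↦ ?_
  have h1 := h.1 v hv
  rw [Units.val_mk0] at h1
  rw [← intValuation_le_pow_iff_mem, ← valuation_of_algebraMap (K := K)]
  change v.valuation K (algebraMap (𝓞 K) K (r - 1)) ≤ _
  rw [map_sub, map_one]
  exact h1

/-- **`w_𝔪 = 1` read on `rayElements`**: if no unit `u ≠ 1` of `𝓞 K` has `u - 1 ∈ 𝔪`, then a unit of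
`𝓞 K` lying in `rayElements 𝔪` is `1`. [cite: deShalit1987, II.1.7 (p. 41)] -/
theorem units_eq_one_of_mem_rayElements {𝔪 : Ideal (𝓞 K)} (h𝔪 : 𝔪 ≠ ⊥)
    (hw : ∀ u : (𝓞 K)ˣ, (u : 𝓞 K) - 1 ∈ 𝔪 → u = 1) (u : (𝓞 K)ˣ)
    (h : Units.map (algebraMap (𝓞 K) K : 𝓞 K →* K) u ∈ rayElements 𝔪) : u = 1 := by
  refine hw u (sub_one_mem_of_unitsMk0_mem_rayElements h𝔪 u.ne_zero ?_)
  have he : Units.mk0 ((u : 𝓞 K) : K) (by exact_mod_cast u.ne_zero) =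
      Units.map (algebraMap (𝓞 K) K : 𝓞 K →* K) u := Units.ext rfl
  rwa [he]

/-! ### §3. `#Cl^𝔪 = [J^𝔪 : P^𝔪]` and multiplicativity -/

/-- `#Cl_K^𝔪 = [J_K^𝔪 : P_K^𝔪]`. [cite: NeukirchANT1999, Ch. VI §1 Def. (1.7)] -/
theorem natCard_rayClassGroup_eq_relIndex (𝔪 : Ideal (𝓞 K)) :
    Nat.card (RayClassGroup 𝔪) = (ray 𝔪).relIndex (idealsPrimeTo 𝔪) := by
  rw [Subgroup.relIndex, Subgroup.index]

/-- `[J : P'] = [P : P'] · [J : P]` for `P' ≤ P ≤ J`. [cite: NeukirchANT1999, Ch. VI §1 Prop. (1.9)] -/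
theorem relIndex_ray_eq_mul {𝔪 𝔪' : Ideal (𝓞 K)} (h𝔪 : 𝔪 ≠ ⊥) (h𝔪' : 𝔪' ≠ ⊥) (hdvd : 𝔪 ∣ 𝔪')
    (hsupp : ∀ v : HeightOneSpectrum (𝓞 K), 𝔪 ≤ v.asIdeal ↔ 𝔪' ≤ v.asIdeal) :
    (ray 𝔪').relIndex (idealsPrimeTo 𝔪') =
      (ray 𝔪').relIndex (ray (K := K) 𝔪) * (ray 𝔪).relIndex (idealsPrimeTo 𝔪) := by
  rw [← idealsPrimeTo_eq_of_forall_le_iff hsupp]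
  exact (Subgroup.relIndex_mul_relIndex (ray 𝔪') (ray 𝔪) (idealsPrimeTo 𝔪) (ray_anti h𝔪' hdvd)
    (ray_le_idealsPrimeTo h𝔪)).symm

/-! ### §4. `[P^𝔪 : P^{𝔪'}] = #ker((𝓞/𝔪')ˣ → (𝓞/𝔪)ˣ)` under `w_𝔪 = 1` -/

section Kernel

variable [IsTotallyComplex K] {𝔪 𝔪' : Ideal (𝓞 K)} (h𝔪 : 𝔪 ≠ ⊥) (h𝔪' : 𝔪' ≠ ⊥) (h𝔪1 : 𝔪' ≠ ⊤)
  (hle : 𝔪' ≤ 𝔪) (hsupp : ∀ v : HeightOneSpectrum (𝓞 K), 𝔪 ≤ v.asIdeal ↔ 𝔪' ≤ v.asIdeal)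
  (hw : ∀ u : (𝓞 K)ˣ, (u : 𝓞 K) - 1 ∈ 𝔪 → u = 1)

omit [NumberField K] [IsTotallyComplex K] in
/-- A lift to `𝓞 K` of a unit class modulo a proper `𝔪'` is non-zero.
[cite: NeukirchANT1999, Ch. VI §1 Prop. (1.9)] -/
theorem ne_zero_of_isUnit_mk (h𝔪1 : 𝔪' ≠ ⊤) {r : 𝓞 K} (hr : IsUnit (Ideal.Quotient.mk 𝔪' r)) : r ≠ 0 := by
  rintro rfl
  rw [map_zero, isUnit_zero_iff] at hr
  exact (Ideal.Quotient.zero_ne_one_iff.mpr h𝔪1) hr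

omit [NumberField K] [IsTotallyComplex K] in
/-- A unit modulo `𝔪'` is prime to `𝔪'`. [cite: NeukirchANT1999, Ch. VI §1 Prop. (1.9)] -/
theorem isCoprime_span_of_isUnit_mk {r : 𝓞 K} (hr : IsUnit (Ideal.Quotient.mk 𝔪' r)) :
    IsCoprime (Ideal.span {r}) 𝔪' := by
  obtain ⟨s, hs⟩ := hr.exists_right_inv
  obtain ⟨s, rfl⟩ := Ideal.Quotient.mk_surjective s
  rw [← map_mul, ← map_one (Ideal.Quotient.mk 𝔪'), Ideal.Quotient.eq] at hs
  rw [Ideal.isCoprime_iff_exists]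
  refine ⟨r * s, Ideal.mem_span_singleton'.mpr ⟨s, mul_comm s r⟩, 1 - r * s, ?_, by ring⟩
  have : 1 - r * s = -(r * s - 1) := by ring
  rw [this]
  exact 𝔪'.neg_mem hs

omit [NumberField K] [IsTotallyComplex K] in
/-- An ideal prime to `𝔪'` is prime to every `𝔪` with the same prime divisors.
[cite: NeukirchANT1999, Ch. VI §1 Prop. (1.9)] -/
theorem isCoprime_of_isCoprime_of_forall_le_iff {I : Ideal (𝓞 K)} (h𝔪 : 𝔪 ≠ ⊥) (h𝔪' : 𝔪' ≠ ⊥)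
    (hsupp : ∀ v : HeightOneSpectrum (𝓞 K), 𝔪 ≤ v.asIdeal ↔ 𝔪' ≤ v.asIdeal)
    (h : IsCoprime I 𝔪') : IsCoprime I 𝔪 := by
  rw [LFunctions.isCoprime_iff_forall_not_le h𝔪] 
  rw [LFunctions.isCoprime_iff_forall_not_le h𝔪'] at h
  exact fun v hv ↦ h v ((hsupp v).mp hv)

include h𝔪 h𝔪' hle hsupp hw in
/-- **KEY**: for integers `a, b ≡ 1 mod 𝔪`, `a` invertible mod `𝔪'`, the principal ideals `(a)`, `(b)`
(both in `P^𝔪`) define the same coset of `P^{𝔪'}` iff `b ≡ a mod 𝔪'` (`⇒` uses `w_𝔪 = 1`: the unit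
`(b/a)/c`, `c ≡ 1 mod 𝔪'`, is `≡ 1 mod 𝔪`, hence `1`). [cite: NeukirchANT1999, Ch. VI §1 Prop. (1.9)]
[cite: deShalit1987, II.1.9 (p. 43)] -/
theorem quotientGroupMk_ray_eq_iff {a b : 𝓞 K} (ha0 : a ≠ 0) (hb0 : b ≠ 0)
    (ha : IsUnit (Ideal.Quotient.mk 𝔪' a)) (ha1 : a - 1 ∈ 𝔪) (hb1 : b - 1 ∈ 𝔪)
    (hau : toPrincipalIdeal (𝓞 K) K (Units.mk0 (a : K) (by exact_mod_cast ha0)) ∈ ray (K := K) 𝔪)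
    (hbu : toPrincipalIdeal (𝓞 K) K (Units.mk0 (b : K) (by exact_mod_cast hb0)) ∈ ray (K := K) 𝔪) :
    (QuotientGroup.mk (s := (ray 𝔪').subgroupOf (ray (K := K) 𝔪)) ⟨_, hau⟩ :
        ↥(ray (K := K) 𝔪) ⧸ (ray 𝔪').subgroupOf (ray (K := K) 𝔪)) =
      QuotientGroup.mk ⟨_, hbu⟩ ↔ b - a ∈ 𝔪' := by
  have hdvd : 𝔪 ∣ 𝔪' := Ideal.dvd_iff_le.mpr hle
  have hacop' : IsCoprime (Ideal.span {a}) 𝔪' := isCoprime_span_of_isUnit_mk ha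
  have hacop : IsCoprime (Ideal.span {a}) 𝔪 := isCoprime_of_isCoprime_of_forall_le_iff h𝔪 h𝔪' hsupp hacop'
  have hq : (Units.mk0 (a : K) (by exact_mod_cast ha0))⁻¹ * Units.mk0 (b : K) (by exact_mod_cast hb0) =
      Units.mk0 ((b : K) / (a : K)) (div_ne_zero (by exact_mod_cast hb0) (by exact_mod_cast ha0)) :=
    Units.ext (by simp [div_eq_mul_inv, mul_comm])
  -- `b/a ≡ 1 mod 𝔪` (as `b ≡ 1 ≡ a mod 𝔪`, `a` prime to `𝔪`)
  have hba : Units.mk0 ((b : K) / (a : K)) (div_ne_zero (by exact_mod_cast hb0) (by exact_mod_cast ha0)) ∈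
      rayElements 𝔪 := by
    refine unitsMk0_div_mem_rayElements_of_sub_mem h𝔪 hb0 ha0 hacop ?_
    have : b - a = (b - 1) - (a - 1) := by ring
    rw [this]
    exact 𝔪.sub_mem hb1 ha1
  rw [QuotientGroup.eq, Subgroup.mem_subgroupOf, Subgroup.coe_mul, Subgroup.coe_inv, ← map_inv,
    ← map_mul, hq]
  constructor
  · intro h
    obtain ⟨c, hc, hcq⟩ := Subgroup.mem_map.mp h
    have hker : c⁻¹ * Units.mk0 ((b : K) / (a : K))
        (div_ne_zero (by exact_mod_cast hb0) (by exact_mod_cast ha0)) ∈ (toPrincipalIdeal (𝓞 K) K).ker := by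
      rw [MonoidHom.mem_ker, map_mul, map_inv, hcq, inv_mul_cancel]
    rw [NumberFields.ker_toPrincipalIdeal, NumberFields.mem_unitsRange_iff] at hker
    obtain ⟨u, hu⟩ := hker
    have huc : Units.map (algebraMap (𝓞 K) K : 𝓞 K →* K) u ∈ rayElements 𝔪 := by
      rw [hu]
      exact mul_mem (inv_mem (rayElements_anti h𝔪' hdvd hc)) hba
    have hu1 : u = 1 := units_eq_one_of_mem_rayElements h𝔪 hw u huc
    rw [hu1, map_one, eq_comm, inv_mul_eq_one, eq_comm] at hu
    have hc' : Units.mk0 ((b : K) / (a : K)) (div_ne_zero (by exact_mod_cast hb0) (by exact_mod_cast ha0)) ∈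
        rayElements 𝔪' := by rw [hu]; exact hc
    exact sub_mem_of_unitsMk0_div_mem_rayElements h𝔪' hb0 ha0 hc'
  · intro h
    exact Subgroup.mem_map.mpr ⟨_, unitsMk0_div_mem_rayElements_of_sub_mem h𝔪' hb0 ha0 hacop' h, rfl⟩

include h𝔪 h𝔪' h𝔪1 hle hsupp hw in
/-- ★ **`[P_K^𝔪 : P_K^{𝔪'}] = #ker((𝓞/𝔪')ˣ → (𝓞/𝔪)ˣ)`** for a totally complex `K`, `𝔪' ≤ 𝔪` with the
same prime divisors, `𝔪' ≠ 𝓞`, and no unit `≠ 1` congruent to `1 mod 𝔪`: the class of `r ∈ 𝓞 K`,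
`r ≡ 1 mod 𝔪`, invertible mod `𝔪'`, goes to the coset `(r)·P^{𝔪'}` — a bijection onto `P^𝔪/P^{𝔪'}`
(injective by the KEY lemma, surjective by inverting a denominator prime to `𝔪` modulo `𝔪'`).
[cite: NeukirchANT1999, Ch. VI §1 Prop. (1.9), Exercise 13] [cite: deShalit1987, II.1.9 (p. 43)] -/
theorem relIndex_ray_ray_eq_natCard_ker :
    (ray 𝔪').relIndex (ray (K := K) 𝔪) =
      Nat.card (Units.map (Ideal.Quotient.factor hle).toMonoidHom :
        (𝓞 K ⧸ 𝔪')ˣ →* (𝓞 K ⧸ 𝔪)ˣ).ker := by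
  have hdvd : 𝔪 ∣ 𝔪' := Ideal.dvd_iff_le.mpr hle
  set red : (𝓞 K ⧸ 𝔪')ˣ →* (𝓞 K ⧸ 𝔪)ˣ := Units.map (Ideal.Quotient.factor hle).toMonoidHom with hred
  -- lifts of kernel classes: `r x ∈ 𝓞 K`, a unit mod `𝔪'`, `≡ 1 mod 𝔪`
  have hlift : ∀ x : red.ker, ∃ r : 𝓞 K, Ideal.Quotient.mk 𝔪' r = ((x : (𝓞 K ⧸ 𝔪')ˣ) : 𝓞 K ⧸ 𝔪') :=
    fun x ↦ Ideal.Quotient.mk_surjective _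
  choose r hr using hlift
  have hru : ∀ x : red.ker, IsUnit (Ideal.Quotient.mk 𝔪' (r x)) := fun x ↦ by
    rw [hr]; exact Units.isUnit _
  have hr0 : ∀ x : red.ker, r x ≠ 0 := fun x ↦ ne_zero_of_isUnit_mk h𝔪1 (hru x)
  have hred_coe : ∀ y : (𝓞 K ⧸ 𝔪')ˣ, ((red y : (𝓞 K ⧸ 𝔪)ˣ) : 𝓞 K ⧸ 𝔪) =
      Ideal.Quotient.factor hle (y : 𝓞 K ⧸ 𝔪') := fun y ↦ rfl
  have hr1 : ∀ x : red.ker, r x - 1 ∈ 𝔪 := fun x ↦ by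
    have hx : red x = 1 := x.2
    rw [← Ideal.Quotient.eq, map_one, ← Ideal.Quotient.factor_mk hle, hr, ← hred_coe, hx, Units.val_one]
  have hmem : ∀ x : red.ker, toPrincipalIdeal (𝓞 K) K (Units.mk0 (r x : K) (by exact_mod_cast hr0 x)) ∈
      ray (K := K) 𝔪 :=
    fun x ↦ Subgroup.mem_map.mpr ⟨_, unitsMk0_mem_rayElements_of_sub_one_mem (hr0 x) (hr1 x), rfl⟩
  let Φ : red.ker → ↥(ray (K := K) 𝔪) ⧸ (ray 𝔪').subgroupOf (ray (K := K) 𝔪) :=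
    fun x ↦ QuotientGroup.mk ⟨_, hmem x⟩
  rw [Subgroup.relIndex, Subgroup.index]
  refine (Nat.card_congr (Equiv.ofBijective Φ ⟨?_, ?_⟩)).symm
  · -- injective: `(r x) ≡ (r y) mod P^{𝔪'}` ⟹ `r y ≡ r x mod 𝔪'` ⟹ `x = y`
    intro x y hxy
    have h := (quotientGroupMk_ray_eq_iff h𝔪 h𝔪' hle hsupp hw (hr0 x) (hr0 y) (hru x) (hr1 x) (hr1 y)
      (hmem x) (hmem y)).mp hxy
    apply Subtype.ext
    apply Units.ext
    rw [← hr x, ← hr y, Ideal.Quotient.eq]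
    have : r x - r y = -(r y - r x) := by ring
    rw [this]
    exact 𝔪'.neg_mem h
  · -- surjective: a coset `(a)·P^{𝔪'}`, `a = b/c ≡ 1 mod 𝔪`, comes from `r = b c'`, `c c' ≡ 1 mod 𝔪'`
    intro q
    induction q using QuotientGroup.induction_on with
    | H z =>
      obtain ⟨I, hI⟩ := z
      obtain ⟨a, ha, rfl⟩ := Subgroup.mem_map.mp hI
      obtain ⟨b, c, hb0, hc0, hccop, hbc, -, heq⟩ := exists_eq_div_of_mem_rayElements h𝔪 ha
      -- `c` is prime to `𝔪'` too; invert it modulo `𝔪'`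
      have hccop' : IsCoprime (Ideal.span {c}) 𝔪' := by
        rw [LFunctions.isCoprime_iff_forall_not_le h𝔪'] 
        rw [LFunctions.isCoprime_iff_forall_not_le h𝔪] at hccop
        exact fun v hv ↦ hccop v ((hsupp v).mpr hv)
      obtain ⟨i, hi, j, hj, hij⟩ := Ideal.isCoprime_iff_exists.mp hccop'
      obtain ⟨c', rfl⟩ := Ideal.mem_span_singleton'.mp hi
      -- so `c' * c + j = 1`, `j ∈ 𝔪'`; put `r := b * c'`
      have hcc' : c * c' - 1 ∈ 𝔪' := by
        have : c * c' - 1 = -j := by rw [← hij]; ring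
        rw [this]; exact 𝔪'.neg_mem hj
      have hbcop : IsCoprime (Ideal.span {b}) 𝔪 := by
        -- `b ≡ c mod 𝔪` and `c` prime to `𝔪`
        rw [Ideal.isCoprime_iff_exists] at hccop ⊢
        obtain ⟨i₀, hi₀, j₀, hj₀, hij₀⟩ := hccop
        obtain ⟨d, rfl⟩ := Ideal.mem_span_singleton'.mp hi₀
        refine ⟨d * b, Ideal.mem_span_singleton'.mpr ⟨d, rfl⟩, j₀ - d * (b - c), ?_, by rw [← hij₀]; ring⟩
        exact 𝔪.sub_mem hj₀ (𝔪.mul_mem_left _ hbc)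
      have hbcop' : IsCoprime (Ideal.span {b}) 𝔪' := by
        rw [LFunctions.isCoprime_iff_forall_not_le h𝔪] at hbcop
        rw [LFunctions.isCoprime_iff_forall_not_le h𝔪']
        exact fun v hv ↦ hbcop v ((hsupp v).mpr hv)
      have hc'cop' : IsCoprime (Ideal.span {c'}) 𝔪' :=
        Ideal.isCoprime_iff_exists.mpr ⟨c' * c, Ideal.mem_span_singleton'.mpr ⟨c, by ring⟩, j, hj, hij⟩
      set rr : 𝓞 K := b * c' with hrr
      have hrr0 : rr ≠ 0 := mul_ne_zero hb0 (by
        rintro rfl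
        rw [mul_zero, zero_sub] at hcc'
        exact h𝔪1 ((Ideal.eq_top_iff_one _).mpr (by simpa using 𝔪'.neg_mem hcc')))
      -- `rr` is a unit mod `𝔪'`
      have hrru : IsUnit (Ideal.Quotient.mk 𝔪' rr) := by
        rw [hrr, map_mul]
        refine IsUnit.mul ?_ ?_
        · obtain ⟨i₁, hi₁, j₁, hj₁, hij₁⟩ := Ideal.isCoprime_iff_exists.mp hbcop'
          obtain ⟨d₁, rfl⟩ := Ideal.mem_span_singleton'.mp hi₁
          refine IsUnit.of_mul_eq_one (Ideal.Quotient.mk 𝔪' d₁) ?_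
          rw [← map_mul, ← map_one (Ideal.Quotient.mk 𝔪'), Ideal.Quotient.eq]
          have : b * d₁ - 1 = -j₁ := by rw [← hij₁]; ring
          rw [this]; exact 𝔪'.neg_mem hj₁
        · refine IsUnit.of_mul_eq_one (Ideal.Quotient.mk 𝔪' c) ?_
          rw [← map_mul, ← map_one (Ideal.Quotient.mk 𝔪'), Ideal.Quotient.eq]
          have : c' * c - 1 = -j := by rw [← hij]; ring
          rw [this]; exact 𝔪'.neg_mem hj
      -- `rr ≡ 1 mod 𝔪`: `b c' ≡ c c' ≡ 1`
      have hrr1 : rr - 1 ∈ 𝔪 := by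
        have : rr - 1 = (b - c) * c' + (c * c' - 1) := by rw [hrr]; ring
        rw [this]
        exact 𝔪.add_mem (𝔪.mul_mem_right _ hbc) (hle hcc')
      -- the kernel element `x` with class `rr`
      have hx : red (hrru.unit) = 1 := by
        apply Units.ext
        rw [hred_coe, IsUnit.unit_spec, Ideal.Quotient.factor_mk, Units.val_one, ← map_one (Ideal.Quotient.mk 𝔪),
          Ideal.Quotient.eq]
        exact hrr1
      refine ⟨⟨hrru.unit, hx⟩, ?_⟩
      -- `Φ x = (r x)·P^{𝔪'} = (rr)·P^{𝔪'}` (same class mod `𝔪'`) `= (a)·P^{𝔪'}` (`(rr)/(a) = (c c')`)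
      have hrx : r ⟨hrru.unit, hx⟩ - rr ∈ 𝔪' := by
        rw [← Ideal.Quotient.eq, hr]
        rfl
      have hmemrr : toPrincipalIdeal (𝓞 K) K (Units.mk0 (rr : K) (by exact_mod_cast hrr0)) ∈ ray (K := K) 𝔪 :=
        Subgroup.mem_map.mpr ⟨_, unitsMk0_mem_rayElements_of_sub_one_mem hrr0 hrr1, rfl⟩
      have step1 : Φ ⟨hrru.unit, hx⟩ = QuotientGroup.mk ⟨_, hmemrr⟩ := by
        refine (quotientGroupMk_ray_eq_iff h𝔪 h𝔪' hle hsupp hw (hr0 _) hrr0 (hru _) (hr1 _) hrr1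
          (hmem _) hmemrr).mpr ?_
        have : rr - r ⟨hrru.unit, hx⟩ = -(r ⟨hrru.unit, hx⟩ - rr) := by ring
        rw [this]; exact 𝔪'.neg_mem hrx
      rw [step1, QuotientGroup.eq, Subgroup.mem_subgroupOf, Subgroup.coe_mul, Subgroup.coe_inv, ← map_inv,
        ← map_mul]
      -- `(rr)⁻¹ · a = (c c')⁻¹`: `a / rr = (b/c)/(b c') = 1/(c c')`, and `c c' ≡ 1 mod 𝔪'`
      have hc'0 : c' ≠ 0 := by rintro rfl; exact hrr0 (by rw [hrr, mul_zero])
      have hcc'0 : c * c' ≠ 0 := mul_ne_zero hc0 hc'0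
      have hq : (Units.mk0 (rr : K) (by exact_mod_cast hrr0))⁻¹ * a =
          (Units.mk0 ((c * c' : 𝓞 K) : K) (by exact_mod_cast hcc'0))⁻¹ := by
        apply Units.ext
        have hbK : (b : K) ≠ 0 := by exact_mod_cast hb0
        have hcK : (c : K) ≠ 0 := by exact_mod_cast hc0
        have hc'K : (c' : K) ≠ 0 := by exact_mod_cast hc'0
        simp only [Units.val_mul, Units.val_inv_eq_inv_val, Units.val_mk0, heq, hrr]
        push_cast
        field_simp
      rw [hq, map_inv]
      exact inv_mem (Subgroup.mem_map.mpr ⟨_, unitsMk0_mem_rayElements_of_sub_one_mem hcc'0 hcc', rfl⟩)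

end Kernel

/-! ### §5. The ray class number ratio -/

/-- ★★ **`#Cl_K^{𝔪'} = #Cl_K^{𝔪} · #ker((𝓞/𝔪')ˣ → (𝓞/𝔪)ˣ)`** for a totally complex `K`, `𝔪' ≤ 𝔪`
(`𝔪' ≠ 𝓞`) with the same prime divisors and no unit `≠ 1` congruent to `1 mod 𝔪` — the exact sequence
`1 → P^𝔪/P^{𝔪'} → Cl^{𝔪'} → Cl^{𝔪} → 1` in cardinality form. For `𝔪 = 𝔣𝔭`, `𝔪' = 𝔣𝔭^{n+1}` this is
`[K(𝔣𝔭^{n+1}) : K(𝔣𝔭)] = #(1+𝔭)/(1+𝔭^{n+1}) = N𝔭^n` (de Shalit II.1.9).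
[cite: NeukirchANT1999, Ch. VI §1 Prop. (1.9), Exercise 13] [cite: deShalit1987, II.1.9 (p. 43)] -/
theorem natCard_rayClassGroup_eq_mul_natCard_ker [IsTotallyComplex K] {𝔪 𝔪' : Ideal (𝓞 K)}
    (h𝔪 : 𝔪 ≠ ⊥) (h𝔪' : 𝔪' ≠ ⊥) (h𝔪1 : 𝔪' ≠ ⊤) (hle : 𝔪' ≤ 𝔪)
    (hsupp : ∀ v : HeightOneSpectrum (𝓞 K), 𝔪 ≤ v.asIdeal ↔ 𝔪' ≤ v.asIdeal)
    (hw : ∀ u : (𝓞 K)ˣ, (u : 𝓞 K) - 1 ∈ 𝔪 → u = 1) :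
    Nat.card (RayClassGroup 𝔪') =
      Nat.card (RayClassGroup 𝔪) *
        Nat.card (Units.map (Ideal.Quotient.factor hle).toMonoidHom :
          (𝓞 K ⧸ 𝔪')ˣ →* (𝓞 K ⧸ 𝔪)ˣ).ker := by
  rw [natCard_rayClassGroup_eq_relIndex, natCard_rayClassGroup_eq_relIndex,
    relIndex_ray_eq_mul h𝔪 h𝔪' (Ideal.dvd_iff_le.mpr hle) hsupp,
    relIndex_ray_ray_eq_natCard_ker h𝔪 h𝔪' h𝔪1 hle hsupp hw, mul_comm]

end Literature.NumberTheory.GaloisRepresentations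

end
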